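/-
Copyright (c) 2026 the pub-hodgecm-mathlib formalisation cell (harness21).  Prover seat hodgecm-mathlib-LH4-p16 (g2), req620 Track A «(D-RAM) FOUR-FRAME» squad
(STAGE-1b, row (2) of the piece `f_{T₊}`, the (β₂) road (R-36); β₂ sub-dealer LH4-p04 (g9) «= ROAD K5∕K6»; CELLREAD-C.sig.v1 hypothesis (hL): K5-C, ninth file), 2026-09-05.
-/
import Summits.HodgeConjecture.HodgeConjecture.Theorems.F0P3cDyRamRowCellDigitTransport        -- ★ p863427 (this seat): the line `{Tr_ρ = 1}` (`map_eq_one_sub_of_trace_one`, `eq_trace_mul_map_point`)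
import Summits.HodgeConjecture.HodgeConjecture.Theorems.F0P3cDyRamThetaNormClassReciprocity   -- ★ p863223 (this seat): `normTheta_mul_map_normTheta`
import HarnessLib

/-!
# Crux `H413`, line LH4 «(D-RAM) FOUR-FRAME» — STAGE-1b, row (2), the (β₂) road (R-36), (ROW-INT) ∕ ‹CORE›, K5-C (9): «THE `Q`-CLASS OF A DIGIT» — all vertices of one literal have
# digits in ONE `Q`-class (exactly), and the `Q`-class is locally constant along the line (CELLREAD-C.sig.v1's hypothesis (hL))

Cell `hodgecm-mathlib` (D-0151), FLOOR 0, crux item H413 = `stmt-HodgeConjecture-24833`, route of record `HCCMUnconditional`; squad F0∕P3c∕LH4; lane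
`--supports stmt-HodgeConjecture-24833 --as helper` (count-neutral; pays NO tier-0 row).  THEOREMS ONLY (no `def`, no instance, no notation, no `sorry`, default heartbeats);
★-only imports; states NO law; (β₂) stays a HYPOTHESIS.  DATUM-FREE one-field letters (`K` with commuting `ρ`, `Θ`, `ρ² = 1`).
WHY (MECH-K3 v1 §2 «literal ⟺ ω(Q(V))»; `F0/P3c/LH4/LH4-p16/g2/CELLREAD-C.sig.v1.LH4p16g2.lean.txt` (hL)).  The digit of a row vertex is `κ̂ = ρu₀∕t` (`u₀ = h·x₀Θx₀`, `t = Tr_ρ u₀`), and the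
transport of ★ p863477 ∕ ★ p863524 between two digits `κ₁, κ₂` is realisable iff `Q(κ₂)∕Q(κ₁)`, `Q := N_ρ`, is the `Θ`-norm of a `ρ`-fixed element (★ p863604).  THIS FILE shows that
this condition holds AUTOMATICALLY between the digits of any two vertices of ONE literal (same `h`), in any two cells: `Q(κ̂) = N_ρ(u₀)∕t²` and
`N_ρ(h·x₀Θx₀)∕N_ρ(h·x₀′Θx₀′) = N_Θ(x₀ρx₀ ∕ x₀′ρx₀′)` (★ p863223 §1), `(t′∕t)² = N_Θ(t′∕t)` — so `Q(κ̂)∕Q(κ̂′) = N_Θ(e)` with `e := (x₀ρx₀∕x₀′ρx₀′)·(t′∕t)` `ρ`-FIXED (§2,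
`exists_fixed_normTheta_normRho_digit_div`): ONE `Q`-class per literal, exactly — the LIT predicate of the SIG is satisfied by every vertex digit.  §1 records the variation of `Q`
along the line: `Q(κ₀ + W₁ξ₀) − Q(κ₀ + W₀ξ₀) = (W₁ − W₀)·ξ₀·(ρ(κ₀ + W₀ξ₀) − (κ₀ + W₁ξ₀))` (`normRho_affinePoint_sub`), whence the local constancy of the class under a `hdeep` letter
(§3 `sameClass_of_near`: two points of the sphere at distance `≤ r₀·R` have `Q`-ratio `≡ 1` to depth `r₀`, hence in one class).
WHAT IS NOT CLAIMED: that digits of the OTHER class are absent from a literal's cell (they are: this file's §2 read backwards), any count.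
HONEST LABEL.  Count-neutral field ∕ valuation algebra; nothing printed is asserted; no census law is stated; `HC_CM` is proved only modulo the 7 printed citations (2 remaining named
inputs: hLiu418 = `stmt-HodgeConjecture-24832`, h413 = `stmt-HodgeConjecture-24833`) until rung 0 closes.
## References
* [Serre1979] J.-P. Serre, *Local Fields*, GTM 67 (1979): Ch. XIV §6 (norm groups of the biquadratic frame), Ch. V §3 Cor. 3.
* [Kottwitz1986BaseChangeUnits] R. E. Kottwitz, *Base change for unit elements of Hecke algebras*, Compositio Math. 60 (1986): §1 pp. 240–241.
* [Jacobowitz1962] R. Jacobowitz, *Hermitian forms over local fields*, Amer. J. Math. 84 (1962): §4.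
-/

set_option autoImplicit false

noncomputable section

namespace Summit.HodgeConjecture.HodgeConjecture.Cruxes.H413.F0P3cDyRamRowCellDigitClass

open scoped Valued WithZero
open WithZero
open Summit.HodgeConjecture.HodgeConjecture.Cruxes.H413.F0P3cDyRamRowCellDigitTransport (map_eq_one_sub_of_trace_one)
open Summit.HodgeConjecture.HodgeConjecture.Cruxes.H413.F0P3cDyRamThetaNormClassReciprocity (normTheta_mul_map_normTheta)

variable {K : Type} [Field K] [Valued K ℤᵐ⁰] {ρ Θ : K →+* K}

/-! ## §1 The variation of `Q = N_ρ` along the line -/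

omit [Valued K ℤᵐ⁰] in
/-- **`Q(κ₀ + W₁ξ₀) − Q(κ₀ + W₀ξ₀) = (W₁ − W₀)·ξ₀·(ρ(κ₀ + W₀ξ₀) − (κ₀ + W₁ξ₀))`** for `ρ`-fixed `W₀, W₁` and anti `ξ₀` (`Q := x ↦ x·ρx`). [cite: Serre1979, Ch. XIV §6] -/
theorem normRho_affinePoint_sub {κ₀ ξ₀ W₀ W₁ : K} (hξ : ρ ξ₀ = -ξ₀) (hW₀ : ρ W₀ = W₀) (hW₁ : ρ W₁ = W₁) :
    (κ₀ + W₁ * ξ₀) * ρ (κ₀ + W₁ * ξ₀) - (κ₀ + W₀ * ξ₀) * ρ (κ₀ + W₀ * ξ₀) =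
      (W₁ - W₀) * ξ₀ * (ρ (κ₀ + W₀ * ξ₀) - (κ₀ + W₁ * ξ₀)) := by
  simp only [map_add, map_mul, hξ, hW₀, hW₁]
  ring

/-- Its size on a sphere: `|κ₀ + W₀ξ₀| = |κ₀ + W₁ξ₀| = R` ⟹ `|Q(κ₀ + W₁ξ₀) − Q(κ₀ + W₀ξ₀)| ≤ |(W₁ − W₀)ξ₀|·R`. [cite: Serre1979, Ch. III §6 Prop. 12] -/
theorem v_normRho_affinePoint_sub_le (hvρ : ∀ x, Valued.v (ρ x) = Valued.v x) {κ₀ ξ₀ W₀ W₁ : K} (hξ : ρ ξ₀ = -ξ₀) (hW₀ : ρ W₀ = W₀) (hW₁ : ρ W₁ = W₁)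
    {R : ℤᵐ⁰} (h₀ : Valued.v (κ₀ + W₀ * ξ₀) = R) (h₁ : Valued.v (κ₀ + W₁ * ξ₀) = R) :
    Valued.v ((κ₀ + W₁ * ξ₀) * ρ (κ₀ + W₁ * ξ₀) - (κ₀ + W₀ * ξ₀) * ρ (κ₀ + W₀ * ξ₀)) ≤ Valued.v ((W₁ - W₀) * ξ₀) * R := by
  rw [normRho_affinePoint_sub hξ hW₀ hW₁, Valuation.map_mul]
  refine mul_le_mul' le_rfl ((Valuation.map_sub _ _ _).trans (max_le ?_ ?_))
  · rw [hvρ, h₀]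
  · rw [h₁]

/-! ## §2 ONE `Q`-class per literal: the digits of any two vertices differ by the `Θ`-norm of a `ρ`-fixed element -/

omit [Valued K ℤᵐ⁰] in
/-- **`Q(κ̂) = N_ρ(u₀)∕t²`** on the line: with `t = Tr_ρ u₀`, `κ̂ = ρu₀∕t`: `κ̂·ρκ̂ = (u₀·ρu₀)∕(t·t)` (`ρ² = 1`; junk-free at `t = 0` by `x∕0 = 0`). [cite: Serre1979, Ch. XIV §6] -/
theorem normRho_digit_eq (hρρ : ∀ x, ρ (ρ x) = x) (u₀ : K) :
    ρ u₀ / (u₀ + ρ u₀) * ρ (ρ u₀ / (u₀ + ρ u₀)) = (u₀ * ρ u₀) / ((u₀ + ρ u₀) * (u₀ + ρ u₀)) := by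
  rw [map_div₀, hρρ, map_add, hρρ, add_comm (ρ u₀) u₀, div_mul_div_comm, mul_comm (ρ u₀) u₀]

omit [Valued K ℤᵐ⁰] in
/-- **`N_ρ(h·x₀Θx₀) = N_ρ(h)·N_Θ(x₀ρx₀)`** (`Θρ = ρΘ`). [cite: Serre1979, Ch. XIV §6] -/
theorem normRho_u₀_eq (hΘρ : ∀ x, Θ (ρ x) = ρ (Θ x)) (h x₀ : K) :
    h * (x₀ * Θ x₀) * ρ (h * (x₀ * Θ x₀)) = (h * ρ h) * ((x₀ * ρ x₀) * Θ (x₀ * ρ x₀)) := by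
  rw [map_mul ρ h, ← normTheta_mul_map_normTheta hΘρ x₀]; ring

omit [Valued K ℤᵐ⁰] in
/-- **ONE `Q`-CLASS PER LITERAL (exact).**  Two vertices of the same literal (same `h ≠ 0`), generators `x₀, x₀′` (`x₀′ ≠ 0`) and ANY doubly-fixed `t, t′ ≠ 0` (at the vertex: the
population scalars `t = Tr_ρ(h·x₀Θx₀)`): `Q(κ̂)∕Q(κ̂′) = eΘe` with `e := (x₀ρx₀)∕(x₀′ρx₀′)·(t′∕t)` and `ρe = e` (`κ̂ = ρ(h x₀Θx₀)∕t`) — the two digits are in ONE `Q`-class, so the transport condition of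
★ p863604 holds between ANY two vertices of a literal, across all cells of the row. [cite: Serre1979, Ch. XIV §6] [cite: Kottwitz1986BaseChangeUnits, §1 pp. 240–241] -/
theorem exists_fixed_normTheta_normRho_digit_div (hρρ : ∀ x, ρ (ρ x) = x) (hΘρ : ∀ x, Θ (ρ x) = ρ (Θ x)) {h x₀ x₀' t t' : K} (hh : h ≠ 0) (hx₀' : x₀' ≠ 0)
    (ht0 : t ≠ 0) (ht'0 : t' ≠ 0)
    (hρt : ρ t = t) (hΘt : Θ t = t) (hρt' : ρ t' = t') (hΘt' : Θ t' = t') :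
    ∃ e : K, ρ e = e ∧ e * Θ e =
      (ρ (h * (x₀ * Θ x₀)) / t * ρ (ρ (h * (x₀ * Θ x₀)) / t)) / (ρ (h * (x₀' * Θ x₀')) / t' * ρ (ρ (h * (x₀' * Θ x₀')) / t')) := by
  have hρh0 : ρ h ≠ 0 := (map_ne_zero ρ).2 hh
  have hN' : x₀' * ρ x₀' ≠ 0 := mul_ne_zero hx₀' ((map_ne_zero ρ).2 hx₀')
  have hΘN' : Θ (x₀' * ρ x₀') ≠ 0 := (map_ne_zero Θ).2 hN'
  have hΘt0 : Θ t ≠ 0 := (map_ne_zero Θ).2 ht0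
  -- `Q(κ̂) = N_ρ(h)·N_Θ(x₀ρx₀) ∕ t²`
  have hQ : ∀ (x t₁ : K), ρ t₁ = t₁ → ρ (h * (x * Θ x)) / t₁ * ρ (ρ (h * (x * Θ x)) / t₁) = (h * ρ h) * ((x * ρ x) * Θ (x * ρ x)) / (t₁ * t₁) := by
    intro x t₁ hρt₁
    rw [map_div₀, hρρ, hρt₁, div_mul_div_comm, mul_comm (ρ (h * (x * Θ x))), normRho_u₀_eq hΘρ h x]
  refine ⟨(x₀ * ρ x₀) / (x₀' * ρ x₀') * (t' / t), ?_, ?_⟩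
  · rw [map_mul, map_div₀, map_div₀, map_mul, map_mul, hρρ, hρρ, hρt, hρt', mul_comm (ρ x₀) x₀, mul_comm (ρ x₀') x₀']
  rw [hQ x₀ t hρt, hQ x₀' t' hρt', map_mul Θ, map_div₀ Θ, map_div₀ Θ, hΘt, hΘt']
  field_simp

/-! ## §3 Local constancy of the class along the line -/

/-- **THE `Q`-CLASS IS LOCALLY CONSTANT ON A SPHERE OF THE LINE.**  `κ₀, ξ₀` (`ρξ₀ = −ξ₀`, both `Θ`-fixed), two `ρ`- and `Θ`-fixed coordinates `W₀, W₁` with the two points on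
one sphere (`|κ₀ + Wᵢξ₀| = |κ₀| ≠ 0`... stated with a common radius `R = |κ₀ + W₀ξ₀|`), at distance `|(W₁ − W₀)ξ₀|·R ≤ r₀·R²`, and the letter `hdeep` («doubly-fixed units `≡ 1` to depth `r₀`
are `Θ`-norms of `ρ`-fixed elements») ⟹ `Q(κ₀ + W₁ξ₀)∕Q(κ₀ + W₀ξ₀) = cΘc` with `ρc = c`: the two digits are in one `Q`-class. [cite: Serre1979, Ch. V §3 Cor. 3; Ch. XIV §6] -/
theorem exists_fixed_normTheta_normRho_div_of_near (hρρ : ∀ x, ρ (ρ x) = x) (hvρ : ∀ x, Valued.v (ρ x) = Valued.v x) (hΘρ : ∀ x, Θ (ρ x) = ρ (Θ x))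
    {κ₀ ξ₀ W₀ W₁ : K} (hξ : ρ ξ₀ = -ξ₀) (hΘκ₀ : Θ κ₀ = κ₀) (hΘξ : Θ ξ₀ = ξ₀)
    (hW₀ : ρ W₀ = W₀) (hW₁ : ρ W₁ = W₁) (hΘW₀ : Θ W₀ = W₀) (hΘW₁ : Θ W₁ = W₁)
    {R : ℤᵐ⁰} (h₀ : Valued.v (κ₀ + W₀ * ξ₀) = R) (h₁ : Valued.v (κ₀ + W₁ * ξ₀) = R) (hR : R ≠ 0)
    {r₀ : ℤᵐ⁰} (hnear : Valued.v ((W₁ - W₀) * ξ₀) ≤ r₀ * R)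
    (hdeep : ∀ u : K, ρ u = u → Θ u = u → Valued.v (u - 1) ≤ r₀ → ∃ c : K, ρ c = c ∧ c * Θ c = u) :
    ∃ c : K, ρ c = c ∧ c * Θ c = ((κ₀ + W₁ * ξ₀) * ρ (κ₀ + W₁ * ξ₀)) / ((κ₀ + W₀ * ξ₀) * ρ (κ₀ + W₀ * ξ₀)) := by
  set Q₀ : K := (κ₀ + W₀ * ξ₀) * ρ (κ₀ + W₀ * ξ₀) with hQ₀
  set Q₁ : K := (κ₀ + W₁ * ξ₀) * ρ (κ₀ + W₁ * ξ₀) with hQ₁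
  have hQ₀v : Valued.v Q₀ = R * R := by rw [hQ₀, Valuation.map_mul, hvρ, h₀]
  have hRpos : (0 : ℤᵐ⁰) < R := zero_lt_iff.2 hR
  have hQ₀0 : Q₀ ≠ 0 := fun h0 => by rw [h0, Valuation.map_zero] at hQ₀v; exact (mul_ne_zero hR hR) hQ₀v.symm
  -- `Q₁ ∕ Q₀` is doubly fixed and `≡ 1` to depth `r₀`
  have hρQ : ∀ W : K, ρ W = W → ρ ((κ₀ + W * ξ₀) * ρ (κ₀ + W * ξ₀)) = (κ₀ + W * ξ₀) * ρ (κ₀ + W * ξ₀) := fun W _ => by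
    rw [map_mul, hρρ, mul_comm]
  have hΘQ : ∀ W : K, Θ W = W → Θ ((κ₀ + W * ξ₀) * ρ (κ₀ + W * ξ₀)) = (κ₀ + W * ξ₀) * ρ (κ₀ + W * ξ₀) := fun W hW => by
    rw [map_mul, hΘρ, map_add, map_mul, hΘκ₀, hΘξ, hW]
  refine hdeep (Q₁ / Q₀) (by rw [map_div₀, hρQ W₁ hW₁, hρQ W₀ hW₀]) (by rw [map_div₀, hΘQ W₁ hΘW₁, hΘQ W₀ hΘW₀]) ?_
  rw [div_sub_one hQ₀0, map_div₀, hQ₀v, div_le_iff₀ (mul_pos hRpos hRpos)]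
  calc Valued.v (Q₁ - Q₀) ≤ Valued.v ((W₁ - W₀) * ξ₀) * R := v_normRho_affinePoint_sub_le hvρ hξ hW₀ hW₁ h₀ h₁
    _ ≤ r₀ * R * R := mul_le_mul' hnear le_rfl
    _ = r₀ * (R * R) := mul_assoc _ _ _

end Summit.HodgeConjecture.HodgeConjecture.Cruxes.H413.F0P3cDyRamRowCellDigitClass

end
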